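import Summits.CriticalPhenomena.PercolationContinuityZ3.Theorems.PercNearOneGluingNoHeavyLowerTailKnQuestion8AntitheticMultiApexTools
import HarnessLib

/-!
# `NoHeavyLowerTail` (crux stmt-CriticalPhenomena-4575), antithetic vdBHK programme: the GENERALIZED APEX LEMMA (tool T20)

Support file (seat `prim-ineq-gen-7` gen 45; `--supports stmt-CriticalPhenomena-4575`).  No `sorry`, no definitions.  Tools in
`…KnQuestion8AntitheticMultiApexTools.lean`; memo run/shared/lean/prim/prim-ineq-gen-7/FINDING-AK-g45.md §3.
SETTING (as in `AntitheticApex`).  `Y` a finite partial order with an involution `ι`, AK in up-set form; `F ⊆ Y` with `F ∩ ιF = ∅` (and, for `A(Y;F)` to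
be a poset, `F × ιF ⊆ (≤)`, `F` minimal, `ιF` maximal — not used by the inequality).  `A(Y;F)` is `Y × {0,1}` with `(y,i) ≤ (y',j) ⟺ y ≤ y'` and: `i = j` if
`y = y' ∈ F ∪ ιF`, anything if `y ∈ F, y' ∈ ιF`, `i ≤ j` otherwise; involution `(y,i) ↦ (ι y, 1-i)`.  `F = {r}` is the apex lemma T18.  ITERATION
(MULTI-APEX): for AK `X` with `r ≤ ι r`, `A_q(X) := X × 2^q` with the fibres over `r`, `ι r` made antichains and `{r} × 2^q < {ι r} × 2^q` equals
`A(A_{q-1}(X); {r} × 2^{q-1})`, hence is AK for all `q`; for poset antimatroids `A_q(Ω_P) = Ω_{P ⊕ A_q}` (q new pairwise incomparable tops), e.g. all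
complete bipartite posets `K_{p,q}`.  Up-sets of `A(Y;F)` = pairs `(U₀,U₁)` of up-sets of `Y` with (α) `U₀ ∖ (F ∪ ιF) ⊆ U₁`, (β) `f ∈ U₀ ∩ F, f ≤ y,
y ∉ F ∪ ιF ⟹ y ∈ U₁`, (γ) `(U₀ ∪ U₁) ∩ F ≠ ∅ ⟹ ιF ⊆ U₀ ∩ U₁`.
* `AntitheticMultiApex.generalized_apex_ak` — **T20**: `#(U₀ ∩ ιW₁) + #(U₁ ∩ ιW₀) ≤ #(U₀ ∩ W₀) + #(U₁ ∩ W₁)` for all such pairs.  PROOF: surgery to the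
  product `Y × {0<1}` (`Ũ₁ ⊇ U₀ ∩ F`; over `ιF` only the forced points), `AntitheticApex.chain_product_ak`, and a four-case count.
-/

namespace Summit.CriticalPhenomena.PercolationContinuityZ3.Theorems

open Finset

namespace AntitheticMultiApex

variable {Y : Type*} [DecidableEq Y] [PartialOrder Y]

section Main
open Classical

/-- **GENERALIZED APEX LEMMA (T20).**  `Y` AK in up-set form, `ι` an involution, `F` a finite set with `f ≤ ι g` for all `f, g ∈ F` and `ι f ∉ F` for
`f ∈ F`.  For all pairs `(U₀,U₁)`, `(W₀,W₁)` of up-sets of `Y` satisfying (α) `y ∉ F, ι y ∉ F, y ∈ U₀ ⟹ y ∈ U₁`, (β) `f ∈ F ∩ U₀, f ≤ y, y ∉ F, ι y ∉ F ⟹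
y ∈ U₁`, (γ) `f ∈ F ∩ (U₀ ∪ U₁), g ∈ F ⟹ ι g ∈ U₀ ∩ U₁` (these are exactly the up-sets of `A(Y;F)`):
`#(U₀ ∩ ιW₁) + #(U₁ ∩ ιW₀) ≤ #(U₀ ∩ W₀) + #(U₁ ∩ W₁)`, i.e. `A(Y;F)` is antipodal Kleitman.  (`hFF` is not needed for the inequality either; it is
what makes the cross relations of `A(Y;F)` order relations.) [this work] -/
theorem generalized_apex_ak (ι : Y → Y) (hιι : Function.Involutive ι)
    (hAK : ∀ V Z : Finset Y, (∀ x y, x ≤ y → x ∈ V → y ∈ V) → (∀ x y, x ≤ y → x ∈ Z → y ∈ Z) →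
      (V ∩ Z.image ι).card ≤ (V ∩ Z).card)
    (F : Finset Y) (hFι : ∀ f ∈ F, ι f ∉ F)
    (U₀ U₁ W₀ W₁ : Finset Y)
    (hU₀ : ∀ x y, x ≤ y → x ∈ U₀ → y ∈ U₀) (hU₁ : ∀ x y, x ≤ y → x ∈ U₁ → y ∈ U₁)
    (hW₀ : ∀ x y, x ≤ y → x ∈ W₀ → y ∈ W₀) (hW₁ : ∀ x y, x ≤ y → x ∈ W₁ → y ∈ W₁)
    (hUa : ∀ y, y ∉ F → ι y ∉ F → y ∈ U₀ → y ∈ U₁)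
    (hUb : ∀ f y, f ∈ F → f ∈ U₀ → f ≤ y → y ∉ F → ι y ∉ F → y ∈ U₁)
    (hUc : ∀ f g, f ∈ F → g ∈ F → (f ∈ U₀ ∨ f ∈ U₁) → (ι g ∈ U₀ ∧ ι g ∈ U₁))
    (hWa : ∀ y, y ∉ F → ι y ∉ F → y ∈ W₀ → y ∈ W₁)
    (hWb : ∀ f y, f ∈ F → f ∈ W₀ → f ≤ y → y ∉ F → ι y ∉ F → y ∈ W₁)
    (hWc : ∀ f g, f ∈ F → g ∈ F → (f ∈ W₀ ∨ f ∈ W₁) → (ι g ∈ W₀ ∧ ι g ∈ W₁)) :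
    (U₀ ∩ W₁.image ι).card + (U₁ ∩ W₀.image ι).card ≤ (U₀ ∩ W₀).card + (U₁ ∩ W₁).card := by
  have hGF : ∀ y, ι y ∈ F → y ∉ F := fun y h hy => (hFι y hy) h
  have memG : ∀ (B : Finset Y) (y : Y), y ∈ B.image ι ↔ ι y ∈ B := fun B y => AntitheticApex.mem_image_invol ι hιι B y
  have hιF : ∀ y, y ∈ F → ι (ι y) ∈ F := fun y hy => by rw [hιι y]; exact hy
  -- surgery sets
  set N0 : Finset Y := U₀.filter (fun y => y ∉ F ∧ ι y ∉ F) with hN0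
  set N1 : Finset Y := U₁.filter (fun y => y ∉ F ∧ ι y ∉ F) with hN1
  set M0 : Finset Y := W₀.filter (fun y => y ∉ F ∧ ι y ∉ F) with hM0
  set M1 : Finset Y := W₁.filter (fun y => y ∉ F ∧ ι y ∉ F) with hM1
  set T0 : Finset Y := (F.image ι).filter (fun g => (∃ f ∈ F, f ∈ U₀ ∨ f ∈ U₁) ∨ ∃ w ∈ N0, w ≤ g) with hT0
  set T1 : Finset Y := (F.image ι).filter (fun g => (∃ f ∈ F, f ∈ U₀ ∨ f ∈ U₁) ∨ ∃ w ∈ N1, w ≤ g) with hT1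
  set S0 : Finset Y := (F.image ι).filter (fun g => (∃ f ∈ F, f ∈ W₀ ∨ f ∈ W₁) ∨ ∃ w ∈ M0, w ≤ g) with hS0
  set S1 : Finset Y := (F.image ι).filter (fun g => (∃ f ∈ F, f ∈ W₀ ∨ f ∈ W₁) ∨ ∃ w ∈ M1, w ≤ g) with hS1
  set V0 : Finset Y := U₀.filter (fun y => y ∈ F) ∪ N0 ∪ T0 with hV0
  set V1 : Finset Y := (U₀ ∪ U₁).filter (fun y => y ∈ F) ∪ N1 ∪ T1 with hV1
  set Z0 : Finset Y := W₀.filter (fun y => y ∈ F) ∪ M0 ∪ S0 with hZ0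
  set Z1 : Finset Y := (W₀ ∪ W₁).filter (fun y => y ∈ F) ∪ M1 ∪ S1 with hZ1
  have upV0 := up_surgery0 ι hιι F hFι U₀ U₁ hU₀ hUc N0 T0 V0 hN0 hT0 hV0
  have upV1 := up_surgery1 ι hιι F hFι U₀ U₁ hU₀ hU₁ hUb hUc N1 T1 V1 hN1 hT1 hV1
  have upZ0 := up_surgery0 ι hιι F hFι W₀ W₁ hW₀ hWc M0 S0 Z0 hM0 hS0 hZ0
  have upZ1 := up_surgery1 ι hιι F hFι W₀ W₁ hW₀ hW₁ hWb hWc M1 S1 Z1 hM1 hS1 hZ1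
  have nV := surgery_nested ι F U₀ U₁ hUa N0 N1 T0 T1 V0 V1 hN0 hN1 hT0 hT1 hV0 hV1; have nZ := surgery_nested ι F W₀ W₁ hWa M0 M1 S0 S1 Z0 Z1 hM0 hM1 hS0 hS1 hZ0 hZ1
  have hP := AntitheticApex.chain_product_ak ι hιι hAK V0 V1 Z0 Z1 upV0 upV1 upZ0 upZ1 nV nZ
  -- region characterisations of the surgery sets
  have hNm : ∀ (A : Finset Y) (y : Y), y ∈ A.filter (fun y => y ∉ F ∧ ι y ∉ F) → y ∉ F ∧ ι y ∉ F :=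
    fun A y hy => (Finset.mem_filter.1 hy).2
  have hTg : ∀ (p : Y → Prop) [DecidablePred p] (y : Y), y ∈ (F.image ι).filter p → ι y ∈ F := by
    intro p _ y hy; exact (memG F y).1 (Finset.mem_filter.1 hy).1
  have mV0 := fun y => mem_surgery ι F hFι U₀ N0 T0 (hNm U₀) (hTg _) y
  have mV1 := fun y => mem_surgery ι F hFι (U₀ ∪ U₁) N1 T1 (hNm U₁) (hTg _) y
  have mZ0 := fun y => mem_surgery ι F hFι W₀ M0 S0 (hNm W₀) (hTg _) y
  have mZ1 := fun y => mem_surgery ι F hFι (W₀ ∪ W₁) M1 S1 (hNm W₁) (hTg _) y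
  rw [← hV0] at mV0; rw [← hV1] at mV1; rw [← hZ0] at mZ0; rw [← hZ1] at mZ1
  -- forced points lie in the up-sets (generic in the layer data)
  have hTsub : ∀ (A₀ A₁ B N : Finset Y) (sel : Bool), (∀ x y, x ≤ y → x ∈ B → y ∈ B) → N ⊆ B →
      (∀ f g, f ∈ F → g ∈ F → (f ∈ A₀ ∨ f ∈ A₁) → (ι g ∈ A₀ ∧ ι g ∈ A₁)) → (∀ z, (z ∈ A₀ ∧ z ∈ A₁) → z ∈ B) →
      (F.image ι).filter (fun g => (∃ f ∈ F, f ∈ A₀ ∨ f ∈ A₁) ∨ ∃ w ∈ N, w ≤ g) ⊆ B := by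
    intro A₀ A₁ B N _ hB hNB hc hsel y hy
    obtain ⟨hyG, hcond⟩ := Finset.mem_filter.1 hy
    rcases hcond with ⟨f, hfF, hf⟩ | ⟨w, hw, hwy⟩
    · have := hc f (ι y) hfF ((memG F y).1 hyG) hf; rw [hιι y] at this; exact hsel y this
    · exact hB w y hwy (hNB hw)
  have hT0U : T0 ⊆ U₀ := hTsub U₀ U₁ U₀ N0 true hU₀ (Finset.filter_subset _ _) hUc (fun z h => h.1)
  have hT1U : T1 ⊆ U₁ := hTsub U₀ U₁ U₁ N1 true hU₁ (Finset.filter_subset _ _) hUc (fun z h => h.2)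
  have hS0W : S0 ⊆ W₀ := hTsub W₀ W₁ W₀ M0 true hW₀ (Finset.filter_subset _ _) hWc (fun z h => h.1)
  have hS1W : S1 ⊆ W₁ := hTsub W₀ W₁ W₁ M1 true hW₁ (Finset.filter_subset _ _) hWc (fun z h => h.2)
  have hT0G : ∀ y, y ∈ T0 → ι y ∈ F := fun y hy => hTg _ y hy; have hT1G : ∀ y, y ∈ T1 → ι y ∈ F := fun y hy => hTg _ y hy
  have hS0G : ∀ y, y ∈ S0 → ι y ∈ F := fun y hy => hTg _ y hy; have hS1G : ∀ y, y ∈ S1 → ι y ∈ F := fun y hy => hTg _ y hy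
  -- the three-way splits
  have sp1 := card_split3 ι F hFι (U₀ ∩ W₀); have sp2 := card_split3 ι F hFι (U₁ ∩ W₁)
  have sp3 := card_split3 ι F hFι (U₀ ∩ W₁.image ι); have sp4 := card_split3 ι F hFι (U₁ ∩ W₀.image ι)
  have sp5 := card_split3 ι F hFι (V0 ∩ Z0); have sp6 := card_split3 ι F hFι (V1 ∩ Z1)
  have sp7 := card_split3 ι F hFι (V0 ∩ Z1.image ι); have sp8 := card_split3 ι F hFι (V1 ∩ Z0.image ι)
  -- middle parts coincide
  have m5 : (V0 ∩ Z0).filter (fun y => y ∉ F ∧ ι y ∉ F) = (U₀ ∩ W₀).filter (fun y => y ∉ F ∧ ι y ∉ F) := by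
    ext y; simp only [Finset.mem_filter, Finset.mem_inter]; constructor
    · rintro ⟨⟨hv, hz⟩, hF, hG⟩
      exact ⟨⟨(Finset.mem_filter.1 (((mV0 y).2.2 hF hG).1 hv)).1, (Finset.mem_filter.1 (((mZ0 y).2.2 hF hG).1 hz)).1⟩, hF, hG⟩
    · rintro ⟨⟨hu, hw⟩, hF, hG⟩
      exact ⟨⟨((mV0 y).2.2 hF hG).2 (Finset.mem_filter.2 ⟨hu, hF, hG⟩), ((mZ0 y).2.2 hF hG).2 (Finset.mem_filter.2 ⟨hw, hF, hG⟩)⟩, hF, hG⟩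
  have m6 : (V1 ∩ Z1).filter (fun y => y ∉ F ∧ ι y ∉ F) = (U₁ ∩ W₁).filter (fun y => y ∉ F ∧ ι y ∉ F) := by
    ext y; simp only [Finset.mem_filter, Finset.mem_inter]; constructor
    · rintro ⟨⟨hv, hz⟩, hF, hG⟩
      exact ⟨⟨(Finset.mem_filter.1 (((mV1 y).2.2 hF hG).1 hv)).1, (Finset.mem_filter.1 (((mZ1 y).2.2 hF hG).1 hz)).1⟩, hF, hG⟩
    · rintro ⟨⟨hu, hw⟩, hF, hG⟩
      exact ⟨⟨((mV1 y).2.2 hF hG).2 (Finset.mem_filter.2 ⟨hu, hF, hG⟩), ((mZ1 y).2.2 hF hG).2 (Finset.mem_filter.2 ⟨hw, hF, hG⟩)⟩, hF, hG⟩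
  have m7 : (V0 ∩ Z1.image ι).filter (fun y => y ∉ F ∧ ι y ∉ F) = (U₀ ∩ W₁.image ι).filter (fun y => y ∉ F ∧ ι y ∉ F) := by
    ext y; simp only [Finset.mem_filter, Finset.mem_inter, memG]; constructor
    · rintro ⟨⟨hv, hz⟩, hF, hG⟩
      have hG' : ι (ι y) ∉ F := by rw [hιι y]; exact hF
      exact ⟨⟨(Finset.mem_filter.1 (((mV0 y).2.2 hF hG).1 hv)).1, (Finset.mem_filter.1 (((mZ1 (ι y)).2.2 hG hG').1 hz)).1⟩, hF, hG⟩
    · rintro ⟨⟨hu, hw⟩, hF, hG⟩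
      have hG' : ι (ι y) ∉ F := by rw [hιι y]; exact hF
      exact ⟨⟨((mV0 y).2.2 hF hG).2 (Finset.mem_filter.2 ⟨hu, hF, hG⟩), ((mZ1 (ι y)).2.2 hG hG').2 (Finset.mem_filter.2 ⟨hw, hG, hG'⟩)⟩, hF, hG⟩
  have m8 : (V1 ∩ Z0.image ι).filter (fun y => y ∉ F ∧ ι y ∉ F) = (U₁ ∩ W₀.image ι).filter (fun y => y ∉ F ∧ ι y ∉ F) := by
    ext y; simp only [Finset.mem_filter, Finset.mem_inter, memG]; constructor
    · rintro ⟨⟨hv, hz⟩, hF, hG⟩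
      have hG' : ι (ι y) ∉ F := by rw [hιι y]; exact hF
      exact ⟨⟨(Finset.mem_filter.1 (((mV1 y).2.2 hF hG).1 hv)).1, (Finset.mem_filter.1 (((mZ0 (ι y)).2.2 hG hG').1 hz)).1⟩, hF, hG⟩
    · rintro ⟨⟨hu, hw⟩, hF, hG⟩
      have hG' : ι (ι y) ∉ F := by rw [hιι y]; exact hF
      exact ⟨⟨((mV1 y).2.2 hF hG).2 (Finset.mem_filter.2 ⟨hu, hF, hG⟩), ((mZ0 (ι y)).2.2 hG hG').2 (Finset.mem_filter.2 ⟨hw, hG, hG'⟩)⟩, hF, hG⟩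
  -- F parts
  have f5 : (V0 ∩ Z0).filter (fun y => y ∈ F) = (U₀ ∩ W₀).filter (fun y => y ∈ F) := by
    ext y; simp only [Finset.mem_filter, Finset.mem_inter]; constructor
    · rintro ⟨⟨hv, hz⟩, hF⟩; exact ⟨⟨((mV0 y).1 hF).1 hv, ((mZ0 y).1 hF).1 hz⟩, hF⟩
    · rintro ⟨⟨hu, hw⟩, hF⟩; exact ⟨⟨((mV0 y).1 hF).2 hu, ((mZ0 y).1 hF).2 hw⟩, hF⟩
  have f6 : (V1 ∩ Z1).filter (fun y => y ∈ F) = (U₀ ∪ U₁).filter (fun y => y ∈ F) ∩ (W₀ ∪ W₁).filter (fun y => y ∈ F) := by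
    ext y; simp only [Finset.mem_filter, Finset.mem_inter]; constructor
    · rintro ⟨⟨hv, hz⟩, hF⟩; exact ⟨⟨((mV1 y).1 hF).1 hv, hF⟩, ((mZ1 y).1 hF).1 hz, hF⟩
    · rintro ⟨⟨hu, hF⟩, hw, _⟩; exact ⟨⟨((mV1 y).1 hF).2 hu, ((mZ1 y).1 hF).2 hw⟩, hF⟩
  have f7 : (V0 ∩ Z1.image ι).filter (fun y => y ∈ F) = (U₀.filter (fun y => y ∈ F)).filter (fun y => ι y ∈ S1) := by
    ext y; simp only [Finset.mem_filter, Finset.mem_inter, memG]; constructor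
    · rintro ⟨⟨hv, hz⟩, hF⟩; exact ⟨⟨((mV0 y).1 hF).1 hv, hF⟩, ((mZ1 (ι y)).2.1 (hιF y hF)).1 hz⟩
    · rintro ⟨⟨hu, hF⟩, hs⟩; exact ⟨⟨((mV0 y).1 hF).2 hu, ((mZ1 (ι y)).2.1 (hιF y hF)).2 hs⟩, hF⟩
  have f8 : (V1 ∩ Z0.image ι).filter (fun y => y ∈ F) = ((U₀ ∪ U₁).filter (fun y => y ∈ F)).filter (fun y => ι y ∈ S0) := by
    ext y; simp only [Finset.mem_filter, Finset.mem_inter, memG]; constructor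
    · rintro ⟨⟨hv, hz⟩, hF⟩; exact ⟨⟨((mV1 y).1 hF).1 hv, hF⟩, ((mZ0 (ι y)).2.1 (hιF y hF)).1 hz⟩
    · rintro ⟨⟨hu, hF⟩, hs⟩; exact ⟨⟨((mV1 y).1 hF).2 hu, ((mZ0 (ι y)).2.1 (hιF y hF)).2 hs⟩, hF⟩
  have f3 : (U₀ ∩ W₁.image ι).filter (fun y => y ∈ F) = (U₀.filter (fun y => y ∈ F)).filter (fun y => ι y ∈ W₁) := by
    ext y; simp only [Finset.mem_filter, Finset.mem_inter, memG]; tauto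
  have f4 : (U₁ ∩ W₀.image ι).filter (fun y => y ∈ F) = (U₁.filter (fun y => y ∈ F)).filter (fun y => ι y ∈ W₀) := by
    ext y; simp only [Finset.mem_filter, Finset.mem_inter, memG]; tauto
  -- G parts
  have g5 : (V0 ∩ Z0).filter (fun y => ι y ∈ F) = T0 ∩ S0 := by
    ext y; simp only [Finset.mem_filter, Finset.mem_inter]; constructor
    · rintro ⟨⟨hv, hz⟩, hG⟩; exact ⟨((mV0 y).2.1 hG).1 hv, ((mZ0 y).2.1 hG).1 hz⟩
    · rintro ⟨ht, hs⟩; exact ⟨⟨((mV0 y).2.1 (hT0G y ht)).2 ht, ((mZ0 y).2.1 (hT0G y ht)).2 hs⟩, hT0G y ht⟩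
  have g6 : (V1 ∩ Z1).filter (fun y => ι y ∈ F) = T1 ∩ S1 := by
    ext y; simp only [Finset.mem_filter, Finset.mem_inter]; constructor
    · rintro ⟨⟨hv, hz⟩, hG⟩; exact ⟨((mV1 y).2.1 hG).1 hv, ((mZ1 y).2.1 hG).1 hz⟩
    · rintro ⟨ht, hs⟩; exact ⟨⟨((mV1 y).2.1 (hT1G y ht)).2 ht, ((mZ1 y).2.1 (hT1G y ht)).2 hs⟩, hT1G y ht⟩
  have g7 : (V0 ∩ Z1.image ι).filter (fun y => ι y ∈ F) = T0.filter (fun y => ι y ∈ W₀ ∪ W₁) := by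
    ext y; simp only [Finset.mem_filter, Finset.mem_inter, memG]; constructor
    · rintro ⟨⟨hv, hz⟩, hG⟩; exact ⟨((mV0 y).2.1 hG).1 hv, ((mZ1 (ι y)).1 hG).1 hz⟩
    · rintro ⟨ht, hw⟩; exact ⟨⟨((mV0 y).2.1 (hT0G y ht)).2 ht, ((mZ1 (ι y)).1 (hT0G y ht)).2 hw⟩, hT0G y ht⟩
  have g8 : (V1 ∩ Z0.image ι).filter (fun y => ι y ∈ F) = T1.filter (fun y => ι y ∈ W₀) := by
    ext y; simp only [Finset.mem_filter, Finset.mem_inter, memG]; constructor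
    · rintro ⟨⟨hv, hz⟩, hG⟩; exact ⟨((mV1 y).2.1 hG).1 hv, ((mZ0 (ι y)).1 hG).1 hz⟩
    · rintro ⟨ht, hw⟩; exact ⟨⟨((mV1 y).2.1 (hT1G y ht)).2 ht, ((mZ0 (ι y)).1 (hT1G y ht)).2 hw⟩, hT1G y ht⟩
  have g3 : (U₀ ∩ W₁.image ι).filter (fun y => ι y ∈ F) = (U₀.filter (fun y => ι y ∈ F)).filter (fun y => ι y ∈ W₁) := by
    ext y; simp only [Finset.mem_filter, Finset.mem_inter, memG]; tauto
  have g4 : (U₁ ∩ W₀.image ι).filter (fun y => ι y ∈ F) = (U₁.filter (fun y => ι y ∈ F)).filter (fun y => ι y ∈ W₀) := by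
    ext y; simp only [Finset.mem_filter, Finset.mem_inter, memG]; tauto
  -- always: surgery G-parts are inside the original G-parts
  have i5 : (T0 ∩ S0).card ≤ ((U₀ ∩ W₀).filter (fun y => ι y ∈ F)).card := by
    apply Finset.card_le_card
    intro y hy
    obtain ⟨ht, hs⟩ := Finset.mem_inter.1 hy
    exact Finset.mem_filter.2 ⟨Finset.mem_inter.2 ⟨hT0U ht, hS0W hs⟩, hT0G y ht⟩
  have i6 : (T1 ∩ S1).card ≤ ((U₁ ∩ W₁).filter (fun y => ι y ∈ F)).card := by
    apply Finset.card_le_card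
    intro y hy
    obtain ⟨ht, hs⟩ := Finset.mem_inter.1 hy
    exact Finset.mem_filter.2 ⟨Finset.mem_inter.2 ⟨hT1U ht, hS1W hs⟩, hT1G y ht⟩
  rw [m5, f5, g5] at sp5; rw [m6, f6, g6] at sp6; rw [m7, f7, g7] at sp7; rw [m8, f8, g8] at sp8
  rw [f3, g3] at sp3; rw [f4, g4] at sp4
  -- case analysis on the presence of bottom points
  by_cases bU : ∃ f ∈ F, f ∈ U₀ ∨ f ∈ U₁ <;> by_cases bW : ∃ f ∈ F, f ∈ W₀ ∨ f ∈ W₁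
  · -- Case 1: bottom points on both sides: T = S = ιF, and ιF ⊆ all four up-sets
    obtain ⟨fU, hfUF, hfU⟩ := bU
    obtain ⟨fW, hfWF, hfW⟩ := bW
    have GU : ∀ y, ι y ∈ F → y ∈ U₀ ∧ y ∈ U₁ := fun y hy => by
      have := hUc fU (ι y) hfUF hy hfU; rwa [hιι y] at this
    have GW : ∀ y, ι y ∈ F → y ∈ W₀ ∧ y ∈ W₁ := fun y hy => by
      have := hWc fW (ι y) hfWF hy hfW; rwa [hιι y] at this
    have hT0e : T0 = F.image ι := Finset.filter_true_of_mem (fun g _ => Or.inl ⟨fU, hfUF, hfU⟩)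
    have hT1e : T1 = F.image ι := Finset.filter_true_of_mem (fun g _ => Or.inl ⟨fU, hfUF, hfU⟩)
    have hS0e : S0 = F.image ι := Finset.filter_true_of_mem (fun g _ => Or.inl ⟨fW, hfWF, hfW⟩)
    have hS1e : S1 = F.image ι := Finset.filter_true_of_mem (fun g _ => Or.inl ⟨fW, hfWF, hfW⟩)
    have eU0G : U₀.filter (fun y => ι y ∈ F) = F.image ι := by
      ext y; simp only [Finset.mem_filter, memG]; exact ⟨fun h => h.2, fun h => ⟨(GU y h).1, h⟩⟩
    have eU1G : U₁.filter (fun y => ι y ∈ F) = F.image ι := by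
      ext y; simp only [Finset.mem_filter, memG]; exact ⟨fun h => h.2, fun h => ⟨(GU y h).2, h⟩⟩
    have e00G : (U₀ ∩ W₀).filter (fun y => ι y ∈ F) = F.image ι := by
      ext y; simp only [Finset.mem_filter, Finset.mem_inter, memG]
      exact ⟨fun h => h.2, fun h => ⟨⟨(GU y h).1, (GW y h).1⟩, h⟩⟩
    have e11G : (U₁ ∩ W₁).filter (fun y => ι y ∈ F) = F.image ι := by
      ext y; simp only [Finset.mem_filter, Finset.mem_inter, memG]
      exact ⟨fun h => h.2, fun h => ⟨⟨(GU y h).2, (GW y h).2⟩, h⟩⟩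
    have c1 : (T0 ∩ S0).card = ((U₀ ∩ W₀).filter (fun y => ι y ∈ F)).card := by
      rw [hT0e, hS0e, e00G, Finset.inter_self]
    have c2 : (T1 ∩ S1).card = ((U₁ ∩ W₁).filter (fun y => ι y ∈ F)).card := by
      rw [hT1e, hS1e, e11G, Finset.inter_self]
    have c3 : ((U₀.filter (fun y => y ∈ F)).filter (fun y => ι y ∈ S1)).card = (U₀.filter (fun y => y ∈ F)).card := by
      rw [Finset.filter_true_of_mem]; intro y hy; rw [hS1e, memG]; exact hιF y (Finset.mem_filter.1 hy).2
    have c3' : ((U₀.filter (fun y => y ∈ F)).filter (fun y => ι y ∈ W₁)).card = (U₀.filter (fun y => y ∈ F)).card := by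
      rw [Finset.filter_true_of_mem]; intro y hy; exact (GW (ι y) (hιF y (Finset.mem_filter.1 hy).2)).2
    have c4 : (((U₀ ∪ U₁).filter (fun y => y ∈ F)).filter (fun y => ι y ∈ S0)).card = ((U₀ ∪ U₁).filter (fun y => y ∈ F)).card := by
      rw [Finset.filter_true_of_mem]; intro y hy; rw [hS0e, memG]; exact hιF y (Finset.mem_filter.1 hy).2
    have c4' : ((U₁.filter (fun y => y ∈ F)).filter (fun y => ι y ∈ W₀)).card = (U₁.filter (fun y => y ∈ F)).card := by
      rw [Finset.filter_true_of_mem]; intro y hy; exact (GW (ι y) (hιF y (Finset.mem_filter.1 hy).2)).1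
    have imF : (F.image ι).image ι = F := by
      rw [Finset.image_image]
      have : ι ∘ ι = id := funext (fun y => hιι y)
      rw [this, Finset.image_id]
    have c5 : (T0.filter (fun y => ι y ∈ W₀ ∪ W₁)).card = ((W₀ ∪ W₁).filter (fun y => y ∈ F)).card := by
      rw [hT0e, card_filter_invol_eq ι hιι, imF, Finset.filter_mem_eq_inter, Finset.inter_comm]
    have c5' : ((U₀.filter (fun y => ι y ∈ F)).filter (fun y => ι y ∈ W₁)).card = (W₁.filter (fun y => y ∈ F)).card := by
      rw [eU0G, card_filter_invol_eq ι hιι, imF, Finset.filter_mem_eq_inter, Finset.inter_comm]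
    have c6 : (T1.filter (fun y => ι y ∈ W₀)).card = ((U₁.filter (fun y => ι y ∈ F)).filter (fun y => ι y ∈ W₀)).card := by
      rw [hT1e, eU1G]
    have e11F : (U₁ ∩ W₁).filter (fun y => y ∈ F) = U₁.filter (fun y => y ∈ F) ∩ W₁.filter (fun y => y ∈ F) :=
      Finset.filter_inter_distrib _ _ _
    have key := card_nested_ineq (U₁.filter (fun y => y ∈ F)) ((U₀ ∪ U₁).filter (fun y => y ∈ F))
      (W₁.filter (fun y => y ∈ F)) ((W₀ ∪ W₁).filter (fun y => y ∈ F))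
      (Finset.filter_subset_filter _ Finset.subset_union_right) (Finset.filter_subset_filter _ Finset.subset_union_right)
    rw [e11F] at sp2
    omega
  · -- Case 2: bottom points in U only: T = ιF ⊆ U₀ ∩ U₁; W has no F-points; S ⊆ W ∩ ιF
    obtain ⟨fU, hfUF, hfU⟩ := bU
    have GU : ∀ y, ι y ∈ F → y ∈ U₀ ∧ y ∈ U₁ := fun y hy => by
      have := hUc fU (ι y) hfUF hy hfU; rwa [hιι y] at this
    have hT0e : T0 = F.image ι := Finset.filter_true_of_mem (fun g _ => Or.inl ⟨fU, hfUF, hfU⟩)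
    have hT1e : T1 = F.image ι := Finset.filter_true_of_mem (fun g _ => Or.inl ⟨fU, hfUF, hfU⟩)
    have nW : ∀ y, y ∈ F → y ∉ W₀ ∧ y ∉ W₁ := fun y hy =>
      ⟨fun h => bW ⟨y, hy, Or.inl h⟩, fun h => bW ⟨y, hy, Or.inr h⟩⟩
    have eWF : (W₀ ∪ W₁).filter (fun y => y ∈ F) = ∅ := by
      apply Finset.filter_false_of_mem; intro y hy hyF
      rcases Finset.mem_union.1 hy with h | h; exact (nW y hyF).1 h; exact (nW y hyF).2 h
    have z1 : ((U₀ ∪ U₁).filter (fun y => y ∈ F) ∩ (W₀ ∪ W₁).filter (fun y => y ∈ F)).card = 0 := by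
      rw [eWF, Finset.inter_empty, Finset.card_empty]
    have z2 : ((U₁ ∩ W₁).filter (fun y => y ∈ F)).card = 0 := by
      rw [Finset.card_eq_zero]; apply Finset.filter_false_of_mem; intro y hy hyF
      exact (nW y hyF).2 (Finset.mem_inter.1 hy).2
    have z3 : (T0.filter (fun y => ι y ∈ W₀ ∪ W₁)).card = 0 := by
      rw [Finset.card_eq_zero]; apply Finset.filter_false_of_mem; intro y hy h
      rcases Finset.mem_union.1 h with h | h; exact (nW _ (hT0G y hy)).1 h; exact (nW _ (hT0G y hy)).2 h
    have z4 : ((U₀.filter (fun y => ι y ∈ F)).filter (fun y => ι y ∈ W₁)).card = 0 := by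
      rw [Finset.card_eq_zero]; apply Finset.filter_false_of_mem; intro y hy h
      exact (nW _ (Finset.mem_filter.1 hy).2).2 h
    have z5 : (T1.filter (fun y => ι y ∈ W₀)).card = 0 := by
      rw [Finset.card_eq_zero]; apply Finset.filter_false_of_mem; intro y hy h
      exact (nW _ (hT1G y hy)).1 h
    have z6 : ((U₁.filter (fun y => ι y ∈ F)).filter (fun y => ι y ∈ W₀)).card = 0 := by
      rw [Finset.card_eq_zero]; apply Finset.filter_false_of_mem; intro y hy h
      exact (nW _ (Finset.mem_filter.1 hy).2).1 h
    -- F-layer transports with defects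
    have eB01 : (U₀.filter (fun y => y ∈ F)).filter (fun y => ι y ∈ W₁)
        = (U₀.filter (fun y => y ∈ F)).filter (fun y => ι y ∈ W₁.filter (fun y => ι y ∈ F)) := by
      ext y; simp only [Finset.mem_filter]; constructor
      · rintro ⟨⟨hu, hF⟩, hw⟩; exact ⟨⟨hu, hF⟩, hw, hιF y hF⟩
      · rintro ⟨⟨hu, hF⟩, hw, _⟩; exact ⟨⟨hu, hF⟩, hw⟩
    have d1 := card_filter_invol_le ι hιι (U₀.filter (fun y => y ∈ F)) (W₁.filter (fun y => ι y ∈ F)) S1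
    rw [← eB01] at d1
    have eB10 : (U₁.filter (fun y => y ∈ F)).filter (fun y => ι y ∈ W₀)
        = (U₁.filter (fun y => y ∈ F)).filter (fun y => ι y ∈ W₀.filter (fun y => ι y ∈ F)) := by
      ext y; simp only [Finset.mem_filter]; constructor
      · rintro ⟨⟨hu, hF⟩, hw⟩; exact ⟨⟨hu, hF⟩, hw, hιF y hF⟩
      · rintro ⟨⟨hu, hF⟩, hw, _⟩; exact ⟨⟨hu, hF⟩, hw⟩
    have d2 := card_filter_invol_le ι hιι (U₁.filter (fun y => y ∈ F)) (W₀.filter (fun y => ι y ∈ F)) S0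
    rw [← eB10] at d2
    have d3 : ((U₁.filter (fun y => y ∈ F)).filter (fun y => ι y ∈ S0)).card
        ≤ (((U₀ ∪ U₁).filter (fun y => y ∈ F)).filter (fun y => ι y ∈ S0)).card :=
      Finset.card_le_card (Finset.filter_subset_filter _ (Finset.filter_subset_filter _ Finset.subset_union_right))
    -- G-layer: T ∩ S = S, and W's G-part splits as S plus the defect
    have hS0sub : S0 ⊆ W₀.filter (fun y => ι y ∈ F) := fun y hy => Finset.mem_filter.2 ⟨hS0W hy, hS0G y hy⟩
    have hS1sub : S1 ⊆ W₁.filter (fun y => ι y ∈ F) := fun y hy => Finset.mem_filter.2 ⟨hS1W hy, hS1G y hy⟩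
    have c1 : (T0 ∩ S0).card = S0.card := by
      rw [hT0e, Finset.inter_eq_right.2 (fun y hy => (Finset.mem_filter.1 hy).1)]
    have c2 : (T1 ∩ S1).card = S1.card := by
      rw [hT1e, Finset.inter_eq_right.2 (fun y hy => (Finset.mem_filter.1 hy).1)]
    have e00G : (U₀ ∩ W₀).filter (fun y => ι y ∈ F) = W₀.filter (fun y => ι y ∈ F) := by
      ext y; simp only [Finset.mem_filter, Finset.mem_inter]
      exact ⟨fun h => ⟨h.1.2, h.2⟩, fun h => ⟨⟨(GU y h.2).1, h.1⟩, h.2⟩⟩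
    have e11G : (U₁ ∩ W₁).filter (fun y => ι y ∈ F) = W₁.filter (fun y => ι y ∈ F) := by
      ext y; simp only [Finset.mem_filter, Finset.mem_inter]
      exact ⟨fun h => ⟨h.1.2, h.2⟩, fun h => ⟨⟨(GU y h.2).2, h.1⟩, h.2⟩⟩
    have c7 := Finset.card_sdiff_add_card_eq_card hS0sub
    have c8 := Finset.card_sdiff_add_card_eq_card hS1sub
    rw [e00G] at sp1; rw [e11G] at sp2
    omega
  · -- Case 3: bottom points in W only (mirror image of case 2)
    obtain ⟨fW, hfWF, hfW⟩ := bW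
    have GW : ∀ y, ι y ∈ F → y ∈ W₀ ∧ y ∈ W₁ := fun y hy => by
      have := hWc fW (ι y) hfWF hy hfW; rwa [hιι y] at this
    have hS0e : S0 = F.image ι := Finset.filter_true_of_mem (fun g _ => Or.inl ⟨fW, hfWF, hfW⟩)
    have hS1e : S1 = F.image ι := Finset.filter_true_of_mem (fun g _ => Or.inl ⟨fW, hfWF, hfW⟩)
    have nU : ∀ y, y ∈ F → y ∉ U₀ ∧ y ∉ U₁ := fun y hy =>
      ⟨fun h => bU ⟨y, hy, Or.inl h⟩, fun h => bU ⟨y, hy, Or.inr h⟩⟩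
    have eU0F : U₀.filter (fun y => y ∈ F) = ∅ := Finset.filter_false_of_mem (fun y hy hyF => (nU y hyF).1 hy)
    have eU1F : U₁.filter (fun y => y ∈ F) = ∅ := Finset.filter_false_of_mem (fun y hy hyF => (nU y hyF).2 hy)
    have eUF : (U₀ ∪ U₁).filter (fun y => y ∈ F) = ∅ := by
      apply Finset.filter_false_of_mem; intro y hy hyF
      rcases Finset.mem_union.1 hy with h | h; exact (nU y hyF).1 h; exact (nU y hyF).2 h
    have z1 : ((U₀ ∪ U₁).filter (fun y => y ∈ F) ∩ (W₀ ∪ W₁).filter (fun y => y ∈ F)).card = 0 := by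
      rw [eUF, Finset.empty_inter, Finset.card_empty]
    have z2 : ((U₁ ∩ W₁).filter (fun y => y ∈ F)).card = 0 := by
      rw [Finset.card_eq_zero]; apply Finset.filter_false_of_mem; intro y hy hyF
      exact (nU y hyF).2 (Finset.mem_inter.1 hy).1
    have z3 : ((U₀.filter (fun y => y ∈ F)).filter (fun y => ι y ∈ S1)).card = 0 := by rw [eU0F, Finset.filter_empty, Finset.card_empty]
    have z4 : ((U₀.filter (fun y => y ∈ F)).filter (fun y => ι y ∈ W₁)).card = 0 := by rw [eU0F, Finset.filter_empty, Finset.card_empty]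
    have z5 : (((U₀ ∪ U₁).filter (fun y => y ∈ F)).filter (fun y => ι y ∈ S0)).card = 0 := by rw [eUF, Finset.filter_empty, Finset.card_empty]
    have z6 : ((U₁.filter (fun y => y ∈ F)).filter (fun y => ι y ∈ W₀)).card = 0 := by rw [eU1F, Finset.filter_empty, Finset.card_empty]
    -- G-layer
    have hT0sub : T0 ⊆ U₀.filter (fun y => ι y ∈ F) := fun y hy => Finset.mem_filter.2 ⟨hT0U hy, hT0G y hy⟩
    have hT1sub : T1 ⊆ U₁.filter (fun y => ι y ∈ F) := fun y hy => Finset.mem_filter.2 ⟨hT1U hy, hT1G y hy⟩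
    have c1 : (T0 ∩ S0).card = T0.card := by
      rw [hS0e, Finset.inter_eq_left.2 (fun y hy => (Finset.mem_filter.1 hy).1)]
    have c2 : (T1 ∩ S1).card = T1.card := by
      rw [hS1e, Finset.inter_eq_left.2 (fun y hy => (Finset.mem_filter.1 hy).1)]
    have e00G : (U₀ ∩ W₀).filter (fun y => ι y ∈ F) = U₀.filter (fun y => ι y ∈ F) := by
      ext y; simp only [Finset.mem_filter, Finset.mem_inter]
      exact ⟨fun h => ⟨h.1.1, h.2⟩, fun h => ⟨⟨h.1, (GW y h.2).1⟩, h.2⟩⟩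
    have e11G : (U₁ ∩ W₁).filter (fun y => ι y ∈ F) = U₁.filter (fun y => ι y ∈ F) := by
      ext y; simp only [Finset.mem_filter, Finset.mem_inter]
      exact ⟨fun h => ⟨h.1.1, h.2⟩, fun h => ⟨⟨h.1, (GW y h.2).2⟩, h.2⟩⟩
    have c7 := Finset.card_sdiff_add_card_eq_card hT0sub
    have c8 := Finset.card_sdiff_add_card_eq_card hT1sub
    have d1 : ((U₀.filter (fun y => ι y ∈ F)).filter (fun y => ι y ∈ W₁)).card
        ≤ (T0.filter (fun y => ι y ∈ W₀ ∪ W₁)).card + (U₀.filter (fun y => ι y ∈ F) \ T0).card := by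
      have hsub : (U₀.filter (fun y => ι y ∈ F)).filter (fun y => ι y ∈ W₁)
          ⊆ T0.filter (fun y => ι y ∈ W₀ ∪ W₁) ∪ (U₀.filter (fun y => ι y ∈ F) \ T0) := by
        intro y hy
        obtain ⟨hyU, hyW⟩ := Finset.mem_filter.1 hy
        rw [Finset.mem_union, Finset.mem_filter, Finset.mem_sdiff]
        by_cases hyT : y ∈ T0
        · exact Or.inl ⟨hyT, Finset.mem_union.2 (Or.inr hyW)⟩
        · exact Or.inr ⟨hyU, hyT⟩
      exact le_trans (Finset.card_le_card hsub) (Finset.card_union_le _ _)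
    have d2 : ((U₁.filter (fun y => ι y ∈ F)).filter (fun y => ι y ∈ W₀)).card
        ≤ (T1.filter (fun y => ι y ∈ W₀)).card + (U₁.filter (fun y => ι y ∈ F) \ T1).card := by
      have hsub : (U₁.filter (fun y => ι y ∈ F)).filter (fun y => ι y ∈ W₀)
          ⊆ T1.filter (fun y => ι y ∈ W₀) ∪ (U₁.filter (fun y => ι y ∈ F) \ T1) := by
        intro y hy
        obtain ⟨hyU, hyW⟩ := Finset.mem_filter.1 hy
        rw [Finset.mem_union, Finset.mem_filter, Finset.mem_sdiff]
        by_cases hyT : y ∈ T1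
        · exact Or.inl ⟨hyT, hyW⟩
        · exact Or.inr ⟨hyU, hyT⟩
      exact le_trans (Finset.card_le_card hsub) (Finset.card_union_le _ _)
    rw [e00G] at sp1; rw [e11G] at sp2
    omega
  · -- Case 4: no bottom points anywhere
    have nU : ∀ y, y ∈ F → y ∉ U₀ ∧ y ∉ U₁ := fun y hy =>
      ⟨fun h => bU ⟨y, hy, Or.inl h⟩, fun h => bU ⟨y, hy, Or.inr h⟩⟩
    have nW : ∀ y, y ∈ F → y ∉ W₀ ∧ y ∉ W₁ := fun y hy =>
      ⟨fun h => bW ⟨y, hy, Or.inl h⟩, fun h => bW ⟨y, hy, Or.inr h⟩⟩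
    have eU0F : U₀.filter (fun y => y ∈ F) = ∅ := Finset.filter_false_of_mem (fun y hy hyF => (nU y hyF).1 hy)
    have eU1F : U₁.filter (fun y => y ∈ F) = ∅ := Finset.filter_false_of_mem (fun y hy hyF => (nU y hyF).2 hy)
    have eUF : (U₀ ∪ U₁).filter (fun y => y ∈ F) = ∅ := by
      apply Finset.filter_false_of_mem; intro y hy hyF
      rcases Finset.mem_union.1 hy with h | h; exact (nU y hyF).1 h; exact (nU y hyF).2 h
    have z1 : ((U₀ ∪ U₁).filter (fun y => y ∈ F) ∩ (W₀ ∪ W₁).filter (fun y => y ∈ F)).card = 0 := by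
      rw [eUF, Finset.empty_inter, Finset.card_empty]
    have z2 : ((U₁ ∩ W₁).filter (fun y => y ∈ F)).card = 0 := by
      rw [Finset.card_eq_zero]; apply Finset.filter_false_of_mem; intro y hy hyF
      exact (nU y hyF).2 (Finset.mem_inter.1 hy).1
    have z3 : ((U₀.filter (fun y => y ∈ F)).filter (fun y => ι y ∈ S1)).card = 0 := by rw [eU0F, Finset.filter_empty, Finset.card_empty]
    have z4 : ((U₀.filter (fun y => y ∈ F)).filter (fun y => ι y ∈ W₁)).card = 0 := by rw [eU0F, Finset.filter_empty, Finset.card_empty]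
    have z5 : (((U₀ ∪ U₁).filter (fun y => y ∈ F)).filter (fun y => ι y ∈ S0)).card = 0 := by rw [eUF, Finset.filter_empty, Finset.card_empty]
    have z6 : ((U₁.filter (fun y => y ∈ F)).filter (fun y => ι y ∈ W₀)).card = 0 := by rw [eU1F, Finset.filter_empty, Finset.card_empty]
    have z7 : (T0.filter (fun y => ι y ∈ W₀ ∪ W₁)).card = 0 := by
      rw [Finset.card_eq_zero]; apply Finset.filter_false_of_mem; intro y hy h
      rcases Finset.mem_union.1 h with h | h; exact (nW _ (hT0G y hy)).1 h; exact (nW _ (hT0G y hy)).2 h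
    have z8 : ((U₀.filter (fun y => ι y ∈ F)).filter (fun y => ι y ∈ W₁)).card = 0 := by
      rw [Finset.card_eq_zero]; apply Finset.filter_false_of_mem; intro y hy h
      exact (nW _ (Finset.mem_filter.1 hy).2).2 h
    have z9 : (T1.filter (fun y => ι y ∈ W₀)).card = 0 := by
      rw [Finset.card_eq_zero]; apply Finset.filter_false_of_mem; intro y hy h
      exact (nW _ (hT1G y hy)).1 h
    have z10 : ((U₁.filter (fun y => ι y ∈ F)).filter (fun y => ι y ∈ W₀)).card = 0 := by
      rw [Finset.card_eq_zero]; apply Finset.filter_false_of_mem; intro y hy h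
      exact (nW _ (Finset.mem_filter.1 hy).2).1 h
    omega
end Main
end AntitheticMultiApex
end Summit.CriticalPhenomena.PercolationContinuityZ3.Theorems
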